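import Mathlib
import Summits.Ventures.HodgeRepro.Tier4.Common.AdelicDefs
import Summits.Ventures.HodgeRepro.Tier4.Common.RowPlane
import Summits.Ventures.HodgeRepro.Tier4.Common.MixedPlaneKType
import Summits.Ventures.HodgeRepro.Tier4.Line1.RTFSetting
import Summits.Ventures.HodgeRepro.Tier4.Line4.OrbitInvariant

/-!
# Tier4/Line4/OrbitInvariantOrbit — the orbit invariant as a function on the RTF orbits `T(k) \ G(k) / T′(k)`

Blind re-derivation cell `pub-hodge-repro`, Tier 4 «prove the step» (README §9–§10), seat t4-L1-p3 (gen 4).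
Tree path `lean/Summits/Ventures/HodgeRepro/Tier4/Line4/OrbitInvariantOrbit.lean`.

`Setting.orbitLift` (generic): a function on `G` constant on `T γ T′` for the ADELIC tori of a Setting descends to the
double-coset quotient `S.Orbit = T(k) \ G(k) / T′(k)` (`Quotient.lift`), with `orbitLift_orbitOf` definitional.
`orbitInv_orbit` (OrbitInvariant) makes `orbitInv W g` such a function when the Setting's tori lie in `torusT W` /
`torusT′ W`, so `orbitInvOrbit … S hT hT' : S.Orbit → Ad k` with `orbitInvOrbit … (S.orbitOf γ) = orbitInv W g γ`.
The FIBRE of the invariant — the exception set of (S1) off which the level-`N` sparsity holds, lead (R-27)/(R-29) —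
is the predicate `orbitInvOrbit … o = orbitInvOrbit … o₀` on orbits, and an orbit is OFF the fibre iff its
representatives have `orbitInv ≠ orbitInv γ₀` (`orbitInv_ne_of_orbitInvOrbit_ne`, `orbitInv_mul_eq_orbitInvOrbit`).
No printed input.  HC_CM is NOT proved by anyone in this repository.
-/

namespace Summit.Ventures.HodgeRepro.Tier4.Line4

open Summit.Ventures.HodgeRepro.Tier4.Common Summit.Ventures.HodgeRepro.Tier4.Line1.RTF NumberField Matrix
open scoped NumberField

noncomputable section

section Lift

variable {G : Type} [Group G] [TopologicalSpace G] [MeasurableSpace G] (S : Setting G) {β : Type}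

/-- **Descent of a `T × T′`-invariant function to the orbits**: a function on `G` constant on `T γ T′` (`T`, `T′` the
adelic tori of the Setting) descends to `S.Orbit = T(k) \ G(k) / T′(k)`. -/
def Setting.orbitLift (F : G → β)
    (hinv : ∀ (τ γ τ' : G), τ ∈ S.T → τ' ∈ S.T' → F (τ * γ * τ') = F γ) : S.Orbit → β :=
  Quotient.lift (s := DoubleCoset.setoid (S.Tk : Set S.Gk) (S.T'k : Set S.Gk))
    (fun γ : S.Gk => F (γ : G)) (by
    intro x y hxy
    obtain ⟨τ, hτ, τ', hτ', rfl⟩ := DoubleCoset.rel_iff.mp hxy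
    show F (x : G) = F ((τ * x * τ' : S.Gk) : G)
    rw [Subgroup.coe_mul, Subgroup.coe_mul]
    exact (hinv _ _ _ (Subgroup.mem_subgroupOf.mp hτ) (Subgroup.mem_subgroupOf.mp hτ')).symm)

/-- The descended function evaluates on a representative. -/
theorem Setting.orbitLift_orbitOf (F : G → β)
    (hinv : ∀ (τ γ τ' : G), τ ∈ S.T → τ' ∈ S.T' → F (τ * γ * τ') = F γ) (γ : S.Gk) :
    Setting.orbitLift S F hinv (S.orbitOf γ) = F (γ : G) := rfl

end Lift

section Orbit

variable {k : Type} [Field k] [NumberField k] (q : QuadData k) (a b ε a' b' ε' : k)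
  (g g' : Matrix (Fin 4) (Fin 4) k) (hgg' : g * g' = 1) (hg'g : g' * g = 1)
  (hgΩ : g * (PlaneData.ofLinesRow q a b ε).Ω = (PlaneData.ofLinesRow q a b ε).Ω * g)
  (W : PlaneData k) (hW : W = (PlaneData.ofLinesRow q a b ε).withTransportedTorus g g' hgg' hg'g hgΩ)
  [MeasurableSpace (GA W)]

include hW in
/-- The invariance of `orbitInv W g` under the Setting's tori, for a Setting whose tori lie in the adelic tori of the
transported row plane. -/
theorem orbitInv_mul_mul_of_le (ha : a ≠ 0) (hb : b ≠ 0) (hε : ε ≠ 0) (ha' : a' ≠ 0) (hb' : b' ≠ 0) (hε' : ε' ≠ 0)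
    (lam : k) (hiso : g * (PlaneData.ofLinesRow q a' b' ε').B * gᵀ = lam • (PlaneData.ofLinesRow q a b ε).B)
    (S : Setting (GA W)) (hT : S.T ≤ torusT W) (hT' : S.T' ≤ torusT' W) :
    ∀ (τ γ τ' : GA W), τ ∈ S.T → τ' ∈ S.T' → orbitInv W g (τ * γ * τ') = orbitInv W g γ := by
  intro τ γ τ' hτ hτ'
  have hτW : τ ∈ torusT W := hT hτ
  have hτ'W : τ' ∈ torusT' W := hT' hτ'
  subst hW
  exact orbitInv_orbit q a b ε a' b' ε' g g' hgg' hg'g hgΩ ha hb hε ha' hb' hε' lam hiso τ γ τ' hτW hτ'W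

/-- **THE INVARIANT ON ORBITS**: `orbitInv W g` descends to `S.Orbit = T(k) \ G(k) / T′(k)` for a Setting whose tori lie
in the adelic tori of the (transported row) plane `W`. -/
def orbitInvOrbit (ha : a ≠ 0) (hb : b ≠ 0) (hε : ε ≠ 0) (ha' : a' ≠ 0) (hb' : b' ≠ 0) (hε' : ε' ≠ 0) (lam : k)
    (hiso : g * (PlaneData.ofLinesRow q a' b' ε').B * gᵀ = lam • (PlaneData.ofLinesRow q a b ε).B)
    (S : Setting (GA W)) (hT : S.T ≤ torusT W) (hT' : S.T' ≤ torusT' W) : S.Orbit → Ad k :=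
  Setting.orbitLift S (orbitInv W g)
    (orbitInv_mul_mul_of_le q a b ε a' b' ε' g g' hgg' hg'g hgΩ W hW ha hb hε ha' hb' hε' lam hiso S hT hT')

/-- The invariant of an orbit is the invariant of any representative. -/
theorem orbitInvOrbit_orbitOf (ha : a ≠ 0) (hb : b ≠ 0) (hε : ε ≠ 0) (ha' : a' ≠ 0) (hb' : b' ≠ 0) (hε' : ε' ≠ 0)
    (lam : k) (hiso : g * (PlaneData.ofLinesRow q a' b' ε').B * gᵀ = lam • (PlaneData.ofLinesRow q a b ε).B)
    (S : Setting (GA W)) (hT : S.T ≤ torusT W) (hT' : S.T' ≤ torusT' W) (γ : S.Gk) :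
    orbitInvOrbit q a b ε a' b' ε' g g' hgg' hg'g hgΩ W hW ha hb hε ha' hb' hε' lam hiso S hT hT' (S.orbitOf γ) =
      orbitInv W g (γ : GA W) := rfl

/-- **OFF THE FIBRE**: if the orbit of `γ` is not in the fibre of the orbit of `γ₀` then `orbitInv γ ≠ orbitInv γ₀` —
the `hne` binder of OrbitInvariantFinite's read-out, for every representative. -/
theorem orbitInv_ne_of_orbitInvOrbit_ne (ha : a ≠ 0) (hb : b ≠ 0) (hε : ε ≠ 0) (ha' : a' ≠ 0) (hb' : b' ≠ 0)
    (hε' : ε' ≠ 0) (lam : k)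
    (hiso : g * (PlaneData.ofLinesRow q a' b' ε').B * gᵀ = lam • (PlaneData.ofLinesRow q a b ε).B)
    (S : Setting (GA W)) (hT : S.T ≤ torusT W) (hT' : S.T' ≤ torusT' W) {γ γ₀ : S.Gk}
    (h : orbitInvOrbit q a b ε a' b' ε' g g' hgg' hg'g hgΩ W hW ha hb hε ha' hb' hε' lam hiso S hT hT' (S.orbitOf γ) ≠
      orbitInvOrbit q a b ε a' b' ε' g g' hgg' hg'g hgΩ W hW ha hb hε ha' hb' hε' lam hiso S hT hT' (S.orbitOf γ₀)) :
    orbitInv W g (γ : GA W) ≠ orbitInv W g (γ₀ : GA W) := h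

/-- The invariant of `τ γ τ'` for torus points of the Setting is the invariant of the orbit of `γ` (the representative
`t⁻¹ γ t'` of OrbitalSupport carries the invariant of its orbit). -/
theorem orbitInv_mul_eq_orbitInvOrbit (ha : a ≠ 0) (hb : b ≠ 0) (hε : ε ≠ 0) (ha' : a' ≠ 0) (hb' : b' ≠ 0)
    (hε' : ε' ≠ 0) (lam : k)
    (hiso : g * (PlaneData.ofLinesRow q a' b' ε').B * gᵀ = lam • (PlaneData.ofLinesRow q a b ε).B)
    (S : Setting (GA W)) (hT : S.T ≤ torusT W) (hT' : S.T' ≤ torusT' W) (τ : S.T) (γ : S.Gk) (τ' : S.T') :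
    orbitInv W g ((τ : GA W) * (γ : GA W) * (τ' : GA W)) =
      orbitInvOrbit q a b ε a' b' ε' g g' hgg' hg'g hgΩ W hW ha hb hε ha' hb' hε' lam hiso S hT hT' (S.orbitOf γ) := by
  rw [orbitInvOrbit_orbitOf]
  exact orbitInv_mul_mul_of_le q a b ε a' b' ε' g g' hgg' hg'g hgΩ W hW ha hb hε ha' hb' hε' lam hiso S hT hT'
    _ _ _ τ.2 τ'.2

end Orbit

end

end Summit.Ventures.HodgeRepro.Tier4.Line4
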